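import Summits.QuantumAdvantage.QuantumAdvantage.Theorems.LocusDialAffinePointerC

/-!
# LocusDialGroupPointerA — the transfer operator with GENERAL UNIT bit phases (part A of 2)

Cell decomp-qadv, seat lens-2, generation 17 — tree part «GroupPointer» of the node «LocusDial»/«StabilizerDial»
(supports item stmt-QuantumAdvantage-27137 `Theses.StabilizerDial.FewLocusLoss3`; it extends the landed «AffinePointer» series
`LocusDialAffinePointerA–D` from `𝔽₃`-linear hashes to hashes with values in an ARBITRARY FINITE ABELIAN GROUP).

THE THEOREM (part B, `groupHashPointerLoss3 : GroupHashPointerLoss3`, constant `C = 1`): in the mod-3 ring game on the odd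
class, for every finite abelian group `V` with `|V| ≤ 2^s`, `s ≤ (log₂ n)^c`, every `g : Fin n → V` and every table
`π : V → Fin n`, the pointer `π(Σ_{i : x_i = 1} g_i)` hits a kernel position (`gCond`) on at most `(1 - 1/n)·2^{n-1}` inputs —
indeed on at most `3/4` of the odd class as soon as `n ≥ 24 s + 98` (`groupHashPointer_loss`).  COROLLARIES (part B):
`parityPointerLoss3` — pointers that are ANY function of `s ≤ (log₂ n)^c` SUBSET PARITIES of the input (a class OUTSIDE low
`𝔽₃`-degree, so outside `FreePointerLoss3`'s hypothesis, yet still losing); `affinePointerLoss3_of_groupHash` — the group law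
dominates the affine law (`V = 𝔽₃^t`); Hamming weight modulo `m` and all mixtures are instances (`V = ℤ/m × …`).

THE METHOD.  Expanding the fibre indicator `[Σ_{x_i=1} g_i = v]` over the character group `AddChar V ℂ` (Mathlib
`AddChar.sum_apply_eq_ite`, `AddChar.card_eq`) turns every error term into an odd-class sum
`Σ_{x odd} (∏_{x_i = 1} θ_i)·χ(a(W_k + W))` with UNIT COMPLEX bit weights `θ_i = ψ(g_i)` — no longer cube roots of unity.  This
file re-runs the two-state transfer recursion of `LocusDialAffinePointerA/B` with general unit weights: `gR`, its `ℓ²`-mass `gQ`,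
the one-step identity `gQ_succ` (`Q_{k+1} = 2Q_k + 4 Re θ_k · Re(R_k(0) conj R_k(1))`), the correlation identity after one step
`gR_corr_succ` (`Re(R_{k+1}(0) conj R_{k+1}(1)) = -Re(R_k(0) conj R_k(1)) + α|R_k(0)|² + β|R_k(1)|²`, `|α|,|β| ≤ 1`, when the
occupation phase `c_k ≠ 0`), whence the UNIFORM TWO-STEP CONTRACTION `gQ_two_step`: `Q_{k+2} ≤ 14·Q_k` for ALL unit
`θ_k, θ_{k+1}` (the cube-root case gave `12`; the trivial bound is `16`), and the closed form `normSq_gR_le`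
(`|R_N(1)|² ≤ 4^{N-2j} 14^j`).  §G lifts it to the weighted walk sums `gS` (hash weight `hashProd θ k x = ∏_{i<k, x_i=1} θ_i`
times the occupation character `χ(phaseK 0 c k x)` of part B): flip symmetry of the half sums (`gH_true_eq_false`), the sum-level
recursion `gS_succ`, the transfer identity `gS_eq : S_k = 2^{N-k} R_k`, and the odd-class bound `normSq_oddSumG_le`.

No `sorry`; standard axioms; no instances, no notation.
-/

set_option linter.dupNamespace false

noncomputable section

open scoped Classical

namespace Summit.QuantumAdvantage.QuantumAdvantage.Theorems.LocusDial

open Finset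
open Literature.Computability.QuantumComplexity Literature.Computability.QuantumComplexity.RingHLF
open Summit.QuantumAdvantage.AdviceFreeQNC0
open Summit.QuantumAdvantage.QuantumAdvantage.Theorems.HolonomyDial (gCond)

/-! ## §F  The transfer recursion with general unit bit phases `θ_k ∈ ℂ`, `|θ_k| = 1` -/

/-- the transfer vector with bit phases `θ` (complex units) and occupation phases `c`. -/
def gR (θ : ℕ → ℂ) (c : ℕ → ZMod 3) : ℕ → Bool → ℂ
  | 0, u => if u then 0 else 1
  | k + 1, u => χ (if u then c k else 0) * (θ k * gR θ c k u + gR θ c k (!u))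

/-- its `ℓ²` mass. -/
def gQ (θ : ℕ → ℂ) (c : ℕ → ZMod 3) (k : ℕ) : ℝ :=
  Complex.normSq (gR θ c k false) + Complex.normSq (gR θ c k true)

/-- LocusDialGroupPointerA helper `gQ_nonneg` (decomp-qadv land package; see the module docstring). -/
theorem gQ_nonneg (θ : ℕ → ℂ) (c : ℕ → ZMod 3) (k : ℕ) : 0 ≤ gQ θ c k :=
  add_nonneg (Complex.normSq_nonneg _) (Complex.normSq_nonneg _)

/-- LocusDialGroupPointerA helper `gQ_zero` (decomp-qadv land package; see the module docstring). -/
theorem gQ_zero (θ : ℕ → ℂ) (c : ℕ → ZMod 3) : gQ θ c 0 = 1 := by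
  simp [gQ, gR]

/-- `|Re θ| ≤ 1` for a unit `θ`. -/
theorem abs_re_le_one_of_normSq {θ : ℂ} (h : Complex.normSq θ = 1) : |θ.re| ≤ 1 := by
  rw [Complex.normSq_apply] at h
  rw [abs_le]
  constructor <;> nlinarith [sq_nonneg θ.im, sq_nonneg (θ.re - 1), sq_nonneg (θ.re + 1)]

/-- `|Re(z θ)| ≤ 1` for units `z`, `θ`. -/
theorem abs_re_mul_le_one {z θ : ℂ} (hz : Complex.normSq z = 1) (h : Complex.normSq θ = 1) : |(z * θ).re| ≤ 1 := by
  apply abs_re_le_one_of_normSq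
  rw [map_mul, hz, h, one_mul]

/-- the ONE-STEP IDENTITY `Q_{k+1} = 2 Q_k + 4·Re θ_k·Re(R_k(0)·conj R_k(1))` (unit `θ_k`). -/
theorem gQ_succ (θ : ℕ → ℂ) (c : ℕ → ZMod 3) (k : ℕ) (hθ : Complex.normSq (θ k) = 1) :
    gQ θ c (k + 1) = 2 * gQ θ c k +
      4 * (θ k).re * (gR θ c k false * (starRingEnd ℂ) (gR θ c k true)).re := by
  set A := gR θ c k false with hA
  set B := gR θ c k true with hB
  have hf : gR θ c (k + 1) false = χ 0 * (θ k * A + B) := by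
    simp [gR, hA, hB]
  have ht : gR θ c (k + 1) true = χ (c k) * (θ k * B + A) := by
    simp [gR, hA, hB]
  unfold gQ
  rw [hf, ht, map_mul, map_mul, normSq_χ, normSq_χ, one_mul, one_mul, Complex.normSq_add, Complex.normSq_add,
    map_mul, map_mul, hθ, one_mul, one_mul]
  have e1 : (θ k * B * (starRingEnd ℂ) A).re = (θ k * (starRingEnd ℂ) (A * (starRingEnd ℂ) B)).re := by
    rw [map_mul, Complex.conj_conj]; ring_nf
  rw [e1, mul_assoc (θ k) A]
  have e2 := re_add_re_conj (θ k) (A * (starRingEnd ℂ) B)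
  rw [← hA, ← hB]
  nlinarith [e2]

/-- one step never more than quadruples the mass. -/
theorem gQ_succ_le (θ : ℕ → ℂ) (c : ℕ → ZMod 3) (k : ℕ) (hθ : Complex.normSq (θ k) = 1) :
    gQ θ c (k + 1) ≤ 4 * gQ θ c k := by
  rw [gQ_succ θ c k hθ]
  have h1 := re_mul_conj_le (gR θ c k false) (gR θ c k true)
  have h2 : |(θ k).re| ≤ 1 := abs_re_le_one_of_normSq hθ
  have h3 := abs_mul (θ k).re (gR θ c k false * (starRingEnd ℂ) (gR θ c k true)).re
  have hQ := gQ_nonneg θ c k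
  unfold gQ at *
  nlinarith [abs_nonneg ((θ k).re), abs_nonneg ((gR θ c k false * (starRingEnd ℂ) (gR θ c k true)).re),
    le_abs_self ((θ k).re * (gR θ c k false * (starRingEnd ℂ) (gR θ c k true)).re),
    mul_le_mul h2 h1 (abs_nonneg _) (by norm_num : (0:ℝ) ≤ 1)]

/-- the correlation after one step: `Re(R_{k+1}(0)·conj R_{k+1}(1)) = -Re(R_k(0) conj R_k(1)) + α|R_k(0)|² + β|R_k(1)|²`
with `|α|, |β| ≤ 1`, as soon as the occupation phase `c_k` is non-zero. -/
theorem gR_corr_succ (θ : ℕ → ℂ) (c : ℕ → ZMod 3) (k : ℕ) (hθ : Complex.normSq (θ k) = 1) (hc : c k ≠ 0) :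
    (gR θ c (k + 1) false * (starRingEnd ℂ) (gR θ c (k + 1) true)).re =
      -(gR θ c k false * (starRingEnd ℂ) (gR θ c k true)).re +
        ((starRingEnd ℂ) (χ (c k)) * θ k).re * Complex.normSq (gR θ c k false) +
        ((starRingEnd ℂ) (χ (c k)) * (starRingEnd ℂ) (θ k)).re * Complex.normSq (gR θ c k true) := by
  set A := gR θ c k false with hA
  set B := gR θ c k true with hB
  have hf : gR θ c (k + 1) false = θ k * A + B := by
    simp [gR, hA, hB, χ_zero]
  have ht : gR θ c (k + 1) true = χ (c k) * (θ k * B + A) := by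
    simp [gR, hA, hB]
  have e0 : θ k * (starRingEnd ℂ) (θ k) = 1 := by
    rw [Complex.mul_conj, hθ]; simp
  have hprod : (θ k * A + B) * (starRingEnd ℂ) (χ (c k) * (θ k * B + A)) =
      (starRingEnd ℂ) (χ (c k)) * (A * (starRingEnd ℂ) B) +
      (starRingEnd ℂ) (χ (c k)) * (starRingEnd ℂ) (A * (starRingEnd ℂ) B) +
      (starRingEnd ℂ) (χ (c k)) * θ k * (A * (starRingEnd ℂ) A) +
      (starRingEnd ℂ) (χ (c k)) * (starRingEnd ℂ) (θ k) * (B * (starRingEnd ℂ) B) := by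
    simp only [map_mul, map_add, Complex.conj_conj]
    linear_combination ((starRingEnd ℂ) (χ (c k)) * A * (starRingEnd ℂ) B) * e0
  rw [hf, ht, hprod, Complex.add_re, Complex.add_re, Complex.add_re]
  have e2 := re_add_re_conj ((starRingEnd ℂ) (χ (c k))) (A * (starRingEnd ℂ) B)
  have hcre : ((starRingEnd ℂ) (χ (c k))).re = -1 / 2 := by rw [Complex.conj_re, χ_re_of_ne hc]
  rw [hcre] at e2
  have eA : ((starRingEnd ℂ) (χ (c k)) * θ k * (A * (starRingEnd ℂ) A)).re =
      ((starRingEnd ℂ) (χ (c k)) * θ k).re * Complex.normSq A := by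
    rw [Complex.mul_conj, Complex.re_mul_ofReal]
  have eB : ((starRingEnd ℂ) (χ (c k)) * (starRingEnd ℂ) (θ k) * (B * (starRingEnd ℂ) B)).re =
      ((starRingEnd ℂ) (χ (c k)) * (starRingEnd ℂ) (θ k)).re * Complex.normSq B := by
    rw [Complex.mul_conj, Complex.re_mul_ofReal]
  rw [eA, eB]
  linarith

/-- the TWO-STEP CONTRACTION for general unit bit phases: `Q_{k+2} ≤ 14·Q_k` when `c_k ≠ 0` (trivial: `16`). -/
theorem gQ_two_step (θ : ℕ → ℂ) (c : ℕ → ZMod 3) (k : ℕ) (hθ : Complex.normSq (θ k) = 1)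
    (hθ' : Complex.normSq (θ (k + 1)) = 1) (hc : c k ≠ 0) : gQ θ c (k + 2) ≤ 14 * gQ θ c k := by
  have hQ1 := gQ_succ θ c k hθ
  have hQ2 : gQ θ c (k + 2) = 2 * gQ θ c (k + 1) +
      4 * (θ (k + 1)).re * (gR θ c (k + 1) false * (starRingEnd ℂ) (gR θ c (k + 1) true)).re :=
    gQ_succ θ c (k + 1) hθ'
  have hr := gR_corr_succ θ c k hθ hc
  set r := (gR θ c k false * (starRingEnd ℂ) (gR θ c k true)).re with hrdef
  set r' := (gR θ c (k + 1) false * (starRingEnd ℂ) (gR θ c (k + 1) true)).re with hr'def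
  set nA := Complex.normSq (gR θ c k false) with hnA
  set nB := Complex.normSq (gR θ c k true) with hnB
  set α := ((starRingEnd ℂ) (χ (c k)) * θ k).re with hα
  set β := ((starRingEnd ℂ) (χ (c k)) * (starRingEnd ℂ) (θ k)).re with hβ
  set p := (θ k).re with hp
  set p' := (θ (k + 1)).re with hp'
  have hχn : Complex.normSq ((starRingEnd ℂ) (χ (c k))) = 1 := by rw [Complex.normSq_conj, normSq_χ]
  have hαle : |α| ≤ 1 := abs_re_mul_le_one hχn hθ
  have hβle : |β| ≤ 1 := abs_re_mul_le_one hχn (by rw [Complex.normSq_conj, hθ])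
  have hple : |p| ≤ 1 := abs_re_le_one_of_normSq hθ
  have hp'le : |p'| ≤ 1 := abs_re_le_one_of_normSq hθ'
  have hrle : |r| ≤ (nA + nB) / 2 := re_mul_conj_le _ _
  have hnA0 : 0 ≤ nA := Complex.normSq_nonneg _
  have hnB0 : 0 ≤ nB := Complex.normSq_nonneg _
  have hQk : gQ θ c k = nA + nB := rfl
  -- the pieces
  have t1 : 8 * p * r ≤ 8 * |r| := by
    have := abs_mul p r
    nlinarith [le_abs_self (p * r), abs_nonneg r, abs_nonneg p, mul_le_mul_of_nonneg_right hple (abs_nonneg r)]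
  have t2 : -(4 * p' * r) ≤ 4 * |r| := by
    have := abs_mul p' r
    nlinarith [neg_abs_le (p' * r), abs_nonneg r, abs_nonneg p', mul_le_mul_of_nonneg_right hp'le (abs_nonneg r)]
  have t3 : 4 * p' * (α * nA) ≤ 4 * nA := by
    have h1 : |p' * α| ≤ 1 := by
      rw [abs_mul]; nlinarith [abs_nonneg p', abs_nonneg α, mul_le_mul hp'le hαle (abs_nonneg α) zero_le_one]
    have h2 : p' * α ≤ 1 := (le_abs_self _).trans h1
    nlinarith [mul_le_mul_of_nonneg_right h2 hnA0]
  have t4 : 4 * p' * (β * nB) ≤ 4 * nB := by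
    have h1 : |p' * β| ≤ 1 := by
      rw [abs_mul]; nlinarith [abs_nonneg p', abs_nonneg β, mul_le_mul hp'le hβle (abs_nonneg β) zero_le_one]
    have h2 : p' * β ≤ 1 := (le_abs_self _).trans h1
    nlinarith [mul_le_mul_of_nonneg_right h2 hnB0]
  rw [hQ2, hQ1, hr, hQk]
  nlinarith [t1, t2, t3, t4, hrle]


end Summit.QuantumAdvantage.QuantumAdvantage.Theorems.LocusDial
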